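import Summits.CriticalPhenomena.SAWScalingLimit.Theses.SAWTotalPositivity
import Summits.CriticalPhenomena.SAWScalingLimit.Theorems.SAWTotalPositivityBoundaryTP2Defs
import Summits.CriticalPhenomena.SAWScalingLimit.Theorems.SAWTotalPositivityBoundaryTP2Kernel
import Summits.CriticalPhenomena.SAWScalingLimit.Theorems.SAWTotalPositivityBoundaryTP2Symmetry
import Summits.CriticalPhenomena.SAWScalingLimit.Theorems.SAWTotalPositivityBoundaryTP2RectFacingPairs
import Summits.CriticalPhenomena.SAWScalingLimit.Theorems.SAWTotalPositivityBoundaryTP2RectReflect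
import Summits.CriticalPhenomena.SAWScalingLimit.Theorems.SAWTotalPositivityBoundaryTP2Strip3Base
import Summits.CriticalPhenomena.SAWScalingLimit.Theorems.SAWTotalPositivityBoundaryTP2Strip3RecMid
import Summits.CriticalPhenomena.SAWScalingLimit.Theorems.SAWTotalPositivityBoundaryTP2Strip3RecCorner
import Summits.CriticalPhenomena.SAWScalingLimit.Theorems.SAWTotalPositivityBoundaryTP2Strip3RecPair
import Summits.CriticalPhenomena.SAWScalingLimit.Theorems.SAWTotalPositivityBoundaryTP2Strip3Interlaced
import Summits.CriticalPhenomena.SAWScalingLimit.Theorems.SAWTotalPositivityBoundaryTP2Strip3EndLower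
import Summits.CriticalPhenomena.SAWScalingLimit.Theorems.SAWTotalPositivityBoundaryTP2Strip3OddCone
import Summits.CriticalPhenomena.SAWScalingLimit.Theorems.SAWTotalPositivityBoundaryTP2Strip3EvenSigns
import Summits.CriticalPhenomena.SAWScalingLimit.Theorems.SAWTotalPositivityBoundaryTP2Strip3CertM2
import Summits.CriticalPhenomena.SAWScalingLimit.Theorems.SAWTotalPositivityBoundaryTP2Strip3EndBounds
import Summits.CriticalPhenomena.SAWScalingLimit.Theorems.EdgeOfPositivity.Negative.EdgeOfPositivityRectDomain
import Literature.Probability.RandomPlanarGeometry.SelfAvoidingWalkProofs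
import Literature.Probability.RandomPlanarGeometry.SAWLowerBound
import HarnessLib

/-!
# Crux `BoundaryTP2` (stmt-CriticalPhenomena-7115), line `Sketch`: the real bridge of the 3-row strip transfer
and the six kernel inequalities of the facing family (lead c6 assembly, part 1)

On the strip `S_L = rectDomain L 2 = {0..L} × {0,1,2}` (lattice adjacency) the self-avoiding path kernels from
the left column obey an exact 5-state last-column transfer recursion (tool stubs `stub_strip3_recCorner`,
`stub_strip3_recMid`, `stub_strip3_recPair`, `stub_strip3_interlaced`, `stub_strip3_base`): three point kernels
`Z_L(r→s)` and two DISJOINT-PAIR kernels `PP_L(r;s)` per start row `r`.  This file turns the `ℝ≥0∞`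
identities into real sequences (`toReal`; everything is finite), feeds them to the pure-real analytic stubs
(`stub_strip3_oddCone` — the odd sector `D = a-c`, `R`; `stub_strip3_evenSigns` — the second-compound sign
pattern of the even sector; `stub_strip3_certM2` — the rate certificate for the delicate minor;
`stub_strip3_endBounds` — decay against the left-end lower bounds of `stub_strip3_endLower`) and obtains, for
every `L ≥ 1` and every `x ∈ [1/3, 5/13]` (the unconditional enclosure of `x_c`), the six real inequalities
`c ≤ a`, `b² ≤ ae`, `ce ≤ b²`, `c ≤ E`, `b ≤ K'`, `ce ≤ K'²` (`strip3_kernel_ineqs`) between the kernels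
`a, b, c = Z((0,0),(L,0)), Z((0,0),(L,1)), Z((0,0),(L,2))`, `e = Z((0,1),(L,1))` and the left-end kernels
`E = Z((0,0),(0,2))`, `K' = Z((0,0),(0,1))`.  Part 2 (`…Strip3FacingTyped.lean`) turns them into the eighteen TP₂
inequalities of the facing family and the crux AS TYPED on every 3-row strip.
-/

noncomputable section

namespace Summit.CriticalPhenomena.SAWScalingLimit.Theorems.BoundaryTP2

open Literature.Probability.LatticeModels Literature.Probability.RandomPlanarGeometry
open Summit.CriticalPhenomena.SAWScalingLimit.Theorems.EdgeOfPositivity.Negative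
open scoped ENNReal

/-! ## Finiteness and the real bridge -/

/-- The strip kernels are finite. [folklore] -/
theorem strip3_ne_top (L : ℕ) (x : ℝ) (a b : Site 2) :
    pathKernel (discreteDomainGraph (rectDomain L 2) 1) x a b ≠ ∞ :=
  pathKernel_ne_top (support_discreteDomainGraph_finite (isBounded_rectDomain L 2) one_pos) x a b

open Classical in
/-- A disjoint-pair kernel is at most the product of the two kernels (drop the disjointness
constraint). [folklore] -/
theorem strip3_pair_le {V : Type*} (H : SimpleGraph V) (x : ℝ) (a b c d : V) :
    (∑' (γ : H.Path a b) (γ' : H.Path c d),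
      (if List.Disjoint γ.1.support γ'.1.support then
        ENNReal.ofReal (x ^ γ.1.length) * ENNReal.ofReal (x ^ γ'.1.length) else 0)) ≤
      pathKernel H x a b * pathKernel H x c d := by
  rw [pathKernel, pathKernel, ← ENNReal.tsum_mul_right]
  refine ENNReal.tsum_le_tsum fun γ => ?_
  rw [← ENNReal.tsum_mul_left]
  refine ENNReal.tsum_le_tsum fun γ' => ?_
  split_ifs
  · exact le_rfl
  · exact bot_le

open Classical in
/-- The strip disjoint-pair kernels are finite. [folklore] -/
theorem strip3_pair_ne_top (L : ℕ) (x : ℝ) (a b c d : Site 2) :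
    (∑' (γ : (discreteDomainGraph (rectDomain L 2) 1).Path a b)
        (γ' : (discreteDomainGraph (rectDomain L 2) 1).Path c d),
      (if List.Disjoint γ.1.support γ'.1.support then
        ENNReal.ofReal (x ^ γ.1.length) * ENNReal.ofReal (x ^ γ'.1.length) else 0)) ≠ ∞ :=
  ne_top_of_le_ne_top (ENNReal.mul_ne_top (strip3_ne_top L x a b) (strip3_ne_top L x c d))
    (strip3_pair_le _ x a b c d)

/-- `toReal` of a four-term transfer identity. [folklore] -/
theorem strip3_toReal4 {x : ℝ} (hx : 0 ≤ x) {A B C D E : ℝ≥0∞} (hB : B ≠ ∞) (hC : C ≠ ∞)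
    (hD : D ≠ ∞) (hE : E ≠ ∞)
    (h : A = ENNReal.ofReal x * B + ENNReal.ofReal (x ^ 2) * C + ENNReal.ofReal (x ^ 3) * D +
      ENNReal.ofReal (x ^ 4) * E) :
    A.toReal = x * B.toReal + x ^ 2 * C.toReal + x ^ 3 * D.toReal + x ^ 4 * E.toReal := by
  rw [h, ENNReal.toReal_add, ENNReal.toReal_add, ENNReal.toReal_add, ENNReal.toReal_mul,
    ENNReal.toReal_mul, ENNReal.toReal_mul, ENNReal.toReal_mul, ENNReal.toReal_ofReal hx,
    ENNReal.toReal_ofReal (pow_nonneg hx 2), ENNReal.toReal_ofReal (pow_nonneg hx 3),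
    ENNReal.toReal_ofReal (pow_nonneg hx 4)]
  all_goals first
    | exact ENNReal.mul_ne_top ENNReal.ofReal_ne_top ‹_›
    | exact ENNReal.add_ne_top.2 ⟨ENNReal.mul_ne_top ENNReal.ofReal_ne_top ‹_›,
        ENNReal.mul_ne_top ENNReal.ofReal_ne_top ‹_›⟩
    | exact ENNReal.add_ne_top.2 ⟨ENNReal.add_ne_top.2 ⟨ENNReal.mul_ne_top ENNReal.ofReal_ne_top ‹_›,
        ENNReal.mul_ne_top ENNReal.ofReal_ne_top ‹_›⟩, ENNReal.mul_ne_top ENNReal.ofReal_ne_top ‹_›⟩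

/-- `toReal` of the three-term middle recursion. [folklore] -/
theorem strip3_toReal3 {x : ℝ} (hx : 0 ≤ x) {A B C D : ℝ≥0∞} (hB : B ≠ ∞) (hC : C ≠ ∞) (hD : D ≠ ∞)
    (h : A = ENNReal.ofReal x * B + ENNReal.ofReal (x ^ 2) * (C + D)) :
    A.toReal = x * B.toReal + x ^ 2 * (C.toReal + D.toReal) := by
  rw [h, ENNReal.toReal_add, ENNReal.toReal_mul, ENNReal.toReal_mul, ENNReal.toReal_add hC hD,
    ENNReal.toReal_ofReal hx, ENNReal.toReal_ofReal (pow_nonneg hx 2)]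
  · exact ENNReal.mul_ne_top ENNReal.ofReal_ne_top hB
  · exact ENNReal.mul_ne_top ENNReal.ofReal_ne_top (ENNReal.add_ne_top.2 ⟨hC, hD⟩)

/-- `toReal` of the two-term pair recursion. [folklore] -/
theorem strip3_toReal2 {x : ℝ} (hx : 0 ≤ x) {A B C : ℝ≥0∞} (hB : B ≠ ∞) (hC : C ≠ ∞)
    (h : A = ENNReal.ofReal (x ^ 2) * B + ENNReal.ofReal (x ^ 3) * C) :
    A.toReal = x ^ 2 * B.toReal + x ^ 3 * C.toReal := by
  rw [h, ENNReal.toReal_add, ENNReal.toReal_mul, ENNReal.toReal_mul,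
    ENNReal.toReal_ofReal (pow_nonneg hx 2), ENNReal.toReal_ofReal (pow_nonneg hx 3)]
  · exact ENNReal.mul_ne_top ENNReal.ofReal_ne_top hB
  · exact ENNReal.mul_ne_top ENNReal.ofReal_ne_top hC

/-! ## The kernel inequalities on every 3-row strip -/

open Classical in
/-- **The six kernel inequalities of the facing family on the 3-row strip `{0..L} × {0,1,2}`**, in real
form, for every `L ≥ 1` and every `x ∈ [1/3, 5/13]`: with `a, b, c` the kernels from `(0,0)` to
`(L,0), (L,1), (L,2)`, `e` the kernel `(0,1) → (L,1)`, `E` the left-end kernel `(0,0) → (0,2)` and `K'`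
the left-end kernel `(0,0) → (0,1)`:
`c ≤ a` [A], `b² ≤ a e` [M1], `c e ≤ b²` [M2], `c ≤ E` [B], `b ≤ K'` [E1], `c e ≤ K'²` [E2].
Proof: the 5-state transfer recursion (stubs C1–C5) turned into real sequences, the analytic stubs
A1–A4, and the left-end lower bounds C6. [folklore] -/
theorem strip3_kernel_ineqs (L : ℕ) (hL : 1 ≤ L) {x : ℝ} (hx1 : 1 / 3 ≤ x) (hx2 : x ≤ 5 / 13) :
    (pathKernel (discreteDomainGraph (rectDomain L 2) 1) x (st 0 0) (st L 2)).toReal ≤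
        (pathKernel (discreteDomainGraph (rectDomain L 2) 1) x (st 0 0) (st L 0)).toReal ∧
      (pathKernel (discreteDomainGraph (rectDomain L 2) 1) x (st 0 0) (st L 1)).toReal ^ 2 ≤
        (pathKernel (discreteDomainGraph (rectDomain L 2) 1) x (st 0 0) (st L 0)).toReal *
          (pathKernel (discreteDomainGraph (rectDomain L 2) 1) x (st 0 1) (st L 1)).toReal ∧
      (pathKernel (discreteDomainGraph (rectDomain L 2) 1) x (st 0 0) (st L 2)).toReal *
          (pathKernel (discreteDomainGraph (rectDomain L 2) 1) x (st 0 1) (st L 1)).toReal ≤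
        (pathKernel (discreteDomainGraph (rectDomain L 2) 1) x (st 0 0) (st L 1)).toReal ^ 2 ∧
      (pathKernel (discreteDomainGraph (rectDomain L 2) 1) x (st 0 0) (st L 2)).toReal ≤
        (pathKernel (discreteDomainGraph (rectDomain L 2) 1) x (st 0 0) (st 0 2)).toReal ∧
      (pathKernel (discreteDomainGraph (rectDomain L 2) 1) x (st 0 0) (st L 1)).toReal ≤
        (pathKernel (discreteDomainGraph (rectDomain L 2) 1) x (st 0 0) (st 0 1)).toReal ∧
      (pathKernel (discreteDomainGraph (rectDomain L 2) 1) x (st 0 0) (st L 2)).toReal *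
          (pathKernel (discreteDomainGraph (rectDomain L 2) 1) x (st 0 1) (st L 1)).toReal ≤
        (pathKernel (discreteDomainGraph (rectDomain L 2) 1) x (st 0 0) (st 0 1)).toReal ^ 2 := by
  have hx0 : 0 ≤ x := by linarith
  -- the real sequences
  set K : ℤ → ℤ → ℕ → ℝ := fun r s n =>
    (pathKernel (discreteDomainGraph (rectDomain n 2) 1) x (st 0 r) (st n s)).toReal with hK
  set PP : ℤ → ℤ → ℕ → ℝ := fun r s n =>
    (∑' (γ : (discreteDomainGraph (rectDomain n 2) 1).Path (st 0 r) (st n s))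
        (γ' : (discreteDomainGraph (rectDomain n 2) 1).Path (st n 1) (st n (2 - s))),
      (if List.Disjoint γ.1.support γ'.1.support then
        ENNReal.ofReal (x ^ γ.1.length) * ENNReal.ofReal (x ^ γ'.1.length) else 0)).toReal with hPP
  -- real recursions
  have recC : ∀ (r : ℤ), 0 ≤ r ∧ r ≤ 2 → ∀ s : ℤ, (s = 0 ∨ s = 2) → ∀ n : ℕ,
      K r s (n + 1) = x * K r s n + x ^ 2 * K r 1 n + x ^ 3 * K r (2 - s) n + x ^ 4 * PP r (2 - s) n := by
    intro r hr s hs n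
    have h := stub_strip3_recCorner n hx0 r hr s hs (stub_strip3_interlaced n r hr s hs)
    have h2s : (2 : ℤ) - (2 - s) = s := by ring
    simp only [hK, hPP]
    rw [h2s]
    exact strip3_toReal4 hx0 (strip3_ne_top _ _ _ _) (strip3_ne_top _ _ _ _) (strip3_ne_top _ _ _ _)
      (strip3_pair_ne_top _ _ _ _ _ _) h
  have recM : ∀ (r : ℤ), 0 ≤ r ∧ r ≤ 2 → ∀ n : ℕ,
      K r 1 (n + 1) = x * K r 1 n + x ^ 2 * (K r 0 n + K r 2 n) := by
    intro r hr n
    simp only [hK]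
    exact strip3_toReal3 hx0 (strip3_ne_top _ _ _ _) (strip3_ne_top _ _ _ _) (strip3_ne_top _ _ _ _)
      (stub_strip3_recMid n hx0 r hr)
  have recP : ∀ (r : ℤ), 0 ≤ r ∧ r ≤ 2 → ∀ s : ℤ, (s = 0 ∨ s = 2) → ∀ n : ℕ,
      PP r s (n + 1) = x ^ 2 * K r s n + x ^ 3 * PP r s n := by
    intro r hr s hs n
    simp only [hK, hPP]
    exact strip3_toReal2 hx0 (strip3_ne_top _ _ _ _) (strip3_pair_ne_top _ _ _ _ _ _)
      (stub_strip3_recPair n hx0 r hr s hs)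
  -- base values
  have baseK : ∀ (r : ℤ), 0 ≤ r ∧ r ≤ 2 → ∀ s : ℤ, 0 ≤ s ∧ s ≤ 2 → K r s 0 = x ^ (r - s).natAbs := by
    intro r hr s hs
    simp only [hK, Nat.cast_zero]
    rw [(stub_strip3_base hx0 r hr).1 s hs, ENNReal.toReal_ofReal (pow_nonneg hx0 _)]
  have baseP : ∀ (r : ℤ), 0 ≤ r ∧ r ≤ 2 → ∀ s : ℤ, (s = 0 ∨ s = 2) →
      PP r s 0 = if r = s then x else 0 := by
    intro r hr s hs
    have h := congrArg ENNReal.toReal ((stub_strip3_base hx0 r hr).2 s hs)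
    refine h.trans ?_
    split_ifs
    · exact ENNReal.toReal_ofReal hx0
    · exact ENNReal.toReal_zero
  have h0 : (0 : ℤ) ≤ 0 ∧ (0 : ℤ) ≤ 2 := ⟨le_rfl, by norm_num⟩
  have h1 : (0 : ℤ) ≤ 1 ∧ (1 : ℤ) ≤ 2 := ⟨by norm_num, by norm_num⟩
  have h2 : (0 : ℤ) ≤ 2 ∧ (2 : ℤ) ≤ 2 := ⟨by norm_num, le_rfl⟩
  have s0 : (0 : ℤ) = 0 ∨ (0 : ℤ) = 2 := Or.inl rfl
  have s2 : (2 : ℤ) = 0 ∨ (2 : ℤ) = 2 := Or.inr rfl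
  -- the eight transfer sequences
  set S : ℕ → ℝ := fun n => K 0 0 n + K 0 2 n with hSdef
  set D : ℕ → ℝ := fun n => K 0 0 n - K 0 2 n with hDdef
  set bq : ℕ → ℝ := fun n => K 0 1 n with hbdef
  set Q : ℕ → ℝ := fun n => PP 0 0 n + PP 0 2 n with hQdef
  set Rq : ℕ → ℝ := fun n => PP 0 0 n - PP 0 2 n with hRdef
  set B : ℕ → ℝ := fun n => K 1 0 n + K 1 2 n with hBdef
  set e : ℕ → ℝ := fun n => K 1 1 n with hedef
  set P : ℕ → ℝ := fun n => PP 1 0 n + PP 1 2 n with hPdef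
  have c00 := recC 0 h0 0 s0
  have c02 := recC 0 h0 2 s2
  have c10 := recC 1 h1 0 s0
  have c12 := recC 1 h1 2 s2
  have m0 := recM 0 h0
  have m1 := recM 1 h1
  have p00 := recP 0 h0 0 s0
  have p02 := recP 0 h0 2 s2
  have p10 := recP 1 h1 0 s0
  have p12 := recP 1 h1 2 s2
  norm_num at c00 c02 c10 c12 p00 p02 p10 p12
  have hS : ∀ n, S (n + 1) = (x + x ^ 3) * S n + 2 * x ^ 2 * bq n + x ^ 4 * Q n := by
    intro n; simp only [hSdef, hbdef, hQdef]; rw [c00 n, c02 n]; ring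
  have hD : ∀ n, D (n + 1) = x * (1 - x ^ 2) * D n - x ^ 4 * Rq n := by
    intro n; simp only [hDdef, hRdef]; rw [c00 n, c02 n]; ring
  have hb : ∀ n, bq (n + 1) = x ^ 2 * S n + x * bq n := by
    intro n; simp only [hSdef, hbdef]; rw [m0 n]; ring
  have hQ : ∀ n, Q (n + 1) = x ^ 2 * S n + x ^ 3 * Q n := by
    intro n; simp only [hSdef, hQdef]; rw [p00 n, p02 n]; ring
  have hR : ∀ n, Rq (n + 1) = x ^ 2 * D n + x ^ 3 * Rq n := by
    intro n; simp only [hDdef, hRdef]; rw [p00 n, p02 n]; ring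
  have hB : ∀ n, B (n + 1) = (x + x ^ 3) * B n + 2 * x ^ 2 * e n + x ^ 4 * P n := by
    intro n; simp only [hBdef, hedef, hPdef]; rw [c10 n, c12 n]; ring
  have he : ∀ n, e (n + 1) = x ^ 2 * B n + x * e n := by
    intro n; simp only [hBdef, hedef]; rw [m1 n]; ring
  have hP : ∀ n, P (n + 1) = x ^ 2 * B n + x ^ 3 * P n := by
    intro n; simp only [hBdef, hPdef]; rw [p10 n, p12 n]; ring
  -- initial values
  have k00 := baseK 0 h0 0 h0
  have k01 := baseK 0 h0 1 h1
  have k02 := baseK 0 h0 2 h2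
  have k10 := baseK 1 h1 0 h0
  have k11 := baseK 1 h1 1 h1
  have k12 := baseK 1 h1 2 h2
  have q00 := baseP 0 h0 0 s0
  have q02 := baseP 0 h0 2 s2
  have q10 := baseP 1 h1 0 s0
  have q12 := baseP 1 h1 2 s2
  norm_num at k00 k01 k02 k10 k11 k12 q00 q02 q10 q12
  have hS0 : S 0 = 1 + x ^ 2 := by simp only [hSdef]; rw [k00, k02]
  have hD0 : D 0 = 1 - x ^ 2 := by simp only [hDdef]; rw [k00, k02]
  have hb0 : bq 0 = x := by simp only [hbdef]; rw [k01]
  have hQ0 : Q 0 = x := by simp only [hQdef]; rw [q00, q02]; ring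
  have hR0 : Rq 0 = x := by simp only [hRdef]; rw [q00, q02]; ring
  have hB0 : B 0 = 2 * x := by simp only [hBdef]; rw [k10, k12]; ring
  have he0 : e 0 = 1 := by simp only [hedef]; rw [k11]
  have hP0 : P 0 = 0 := by simp only [hPdef]; rw [q10, q12]; ring
  -- symmetry `B = 2 b`: `Z((0,1),(L,0)) = Z((0,1),(L,2)) = Z((0,0),(L,1))`
  have hsym : ∀ n, B n = 2 * bq n := by
    intro n
    simp only [hBdef, hbdef, hK]
    have hA := (stub_rect_reflect n 2 x 0 1 n 0).2
    have hB' := (stub_rect_reflect n 2 x 0 1 n 2).1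
    have hC := (stub_rect_reflect n 2 x 0 2 n 1).2
    norm_num at hA hB' hC
    rw [hA, hB', pathKernel_comm _ x (st (n : ℤ) 1) (st 0 2), hC]
    ring
  -- the analytic stubs
  have hcone := stub_strip3_oddCone hx0 (by linarith) D Rq hD0 hR0 hD hR
  have hsg := stub_strip3_evenSigns hx0 (by linarith) S bq Q B e P hS0 hb0 hQ0 hB0 he0 hP0 hS hb hQ hB he hP
  have hm2 := stub_strip3_certM2 hx1 hx2 S bq Q B e P D Rq hS0 hb0 hQ0 hB0 he0 hP0 hD0 hR0
    hS hb hQ hB he hP hD hR hsym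
  have hend := stub_strip3_endBounds hx1 hx2 S bq Q B e P D Rq hS0 hb0 hQ0 hB0 he0 hP0 hD0 hR0
    hS hb hQ hB he hP hD hR (fun n => (hcone n).1) L hL
  obtain ⟨hDL, -, -⟩ := hcone L
  obtain ⟨⟨-, -, -, -, heL, -⟩, hM1, -, -⟩ := hsg L
  have hM2 := hm2 L
  obtain ⟨hE1, hE2, hE3⟩ := hend
  -- the left-end lower bounds
  obtain ⟨hlowE, hlowK, -⟩ := stub_strip3_endLower L hL hx0
  have hlowE' : x ^ 2 + 3 * x ^ 4 ≤
      (pathKernel (discreteDomainGraph (rectDomain L 2) 1) x (st 0 0) (st 0 2)).toReal :=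
    (ENNReal.ofReal_le_iff_le_toReal (strip3_ne_top _ _ _ _)).1 hlowE
  have hlowK' : x + x ^ 3 + x ^ 5 ≤
      (pathKernel (discreteDomainGraph (rectDomain L 2) 1) x (st 0 0) (st 0 1)).toReal :=
    (ENNReal.ofReal_le_iff_le_toReal (strip3_ne_top _ _ _ _)).1 hlowK
  -- restate the goal through the sequences (definitional unfolding of `K`)
  have eS : S L = K 0 0 L + K 0 2 L := rfl
  have eD : D L = K 0 0 L - K 0 2 L := rfl
  have eb : bq L = K 0 1 L := rfl
  have ee : e L = K 1 1 L := rfl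
  have eB : B L = 2 * bq L := hsym L
  have hKpos : 0 ≤ x + x ^ 3 + x ^ 5 := by positivity
  show K 0 2 L ≤ K 0 0 L ∧ K 0 1 L ^ 2 ≤ K 0 0 L * K 1 1 L ∧ K 0 2 L * K 1 1 L ≤ K 0 1 L ^ 2 ∧
    K 0 2 L ≤ (pathKernel (discreteDomainGraph (rectDomain L 2) 1) x (st 0 0) (st 0 2)).toReal ∧
    K 0 1 L ≤ (pathKernel (discreteDomainGraph (rectDomain L 2) 1) x (st 0 0) (st 0 1)).toReal ∧
    K 0 2 L * K 1 1 L ≤ (pathKernel (discreteDomainGraph (rectDomain L 2) 1) x (st 0 0) (st 0 1)).toReal ^ 2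
  clear_value S D bq Q Rq B e P PP K
  refine ⟨?_, ?_, ?_, ?_, ?_, ?_⟩
  · -- [A] `c ≤ a` from `D ≥ 0`
    linarith [hDL, eD]
  · -- [M1] `b² ≤ a e` from `S e - b B ≥ 0`, `D ≥ 0`
    rw [eB] at hM1
    rw [eS, eb, ee] at hM1
    rw [eD] at hDL
    rw [ee] at heL
    nlinarith [hM1, mul_nonneg hDL heL]
  · -- [M2]
    rw [eS, eD, eb, ee] at hM2
    have hid : (K 0 0 L + K 0 2 L - (K 0 0 L - K 0 2 L)) * K 1 1 L = 2 * (K 0 2 L * K 1 1 L) := by ring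
    rw [hid] at hM2
    exact le_of_mul_le_mul_left hM2 two_pos
  · -- [B] `c ≤ x² + 3x⁴ ≤ E`
    rw [eS, eD] at hE1
    linarith [hE1, hlowE']
  · -- [E1]
    rw [eb] at hE2
    linarith [hE2, hlowK']
  · -- [E2] `c e ≤ (x + x³ + x⁵)² ≤ K'²`
    have hsq : (x + x ^ 3 + x ^ 5) ^ 2 ≤
        (pathKernel (discreteDomainGraph (rectDomain L 2) 1) x (st 0 0) (st 0 1)).toReal ^ 2 :=
      pow_le_pow_left₀ hKpos hlowK' 2
    rw [eS, eD, ee] at hE3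
    have hid : (K 0 0 L + K 0 2 L - (K 0 0 L - K 0 2 L)) * K 1 1 L = 2 * (K 0 2 L * K 1 1 L) := by ring
    rw [hid] at hE3
    exact (le_of_mul_le_mul_left hE3 two_pos).trans hsq

end Summit.CriticalPhenomena.SAWScalingLimit.Theorems.BoundaryTP2
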